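import Literature.NumberTheory.LFunctions.RudnickSarnakNCellFactors
import HarnessLib

/-!
# Rudnick–Sarnak `n`-level correlations for `ζ`, XVII: the limit of a cell integral

Sibling file of `Literature/NumberTheory/LFunctions/RudnickSarnak.lean` (toward
`Literature.NumberTheory.LFunctions.rudnick_sarnak_unrestricted` at every level). The main term
`E' = ∅` of the `β` cell integral (`RudnickSarnakNCellFactors.lean`), in the variables of
`RudnickSarnakNCellTransform.lean`, is `L^{1−|D|} ∫ H_T(η) dη` with

  `H_T(η) = Φ(ξ_T(η)) 1_{cell}(ξ_T(η)) W(η) V_T(η)`,  `ξ_T(η) = ξ_∞(η) + L⁻¹ ρ(η)`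

(`RudnickSarnakN.HT`, `RudnickSarnakN.scaled_JE_empty_eq`), where `W` is the product of the
kernels `g₀`, `K` of the dilated coordinates and of the kernel of the dependent slot evaluated at
the linear form `λ`, and `V_T → V_∞ = Π_p v_p` are the pair weights. By dominated convergence
(Rudnick–Sarnak 1996, (3.73)–(3.74)) `∫ H_T → ∫ H_∞`, and `∫ H_∞ = c_n · I_β(Φ)` splits into the
universal constant `c_n = (2π)⁻¹ ∫ κⁿ` (`RudnickSarnakNSliceChange.lean`) and the pair integral
`I_β(Φ)` over the weights (`RudnickSarnakN.pairInt`; identified with the matching term of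
`rsPairingFunctional` in the next file). With the error terms of `RudnickSarnakNCellFactors.lean`
and `I_m(T) ∼ T Lᵐ` this gives the limit of `cellCoef · cellMain/(T L)`
(`RudnickSarnakN.tendsto_cellCoef_mul_cellMain_div`).

## References

* Z. Rudnick, P. Sarnak, *Zeros of principal `L`-functions and random matrix theory*, Duke Math.
  J. 81 (1996), 269–322, (3.69)–(3.74), Lemma 3.6.
-/

noncomputable section

open Complex Filter Set MeasureTheory Finset
open scoped Real Topology

namespace Literature.NumberTheory.LFunctions

namespace RudnickSarnakN

variable {k : ℕ}

section Pattern

variable {D P : Finset (Fin (k + 1))} {β : ↥P ≃ ↥((Finset.univ \ D) \ P)}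

/-! ## The limit point and the direction of approach -/

variable (D P β) in
/-- **The limit slice point** `ξ_∞(η)`: `0` on `D`, `−η_{prt i}` on the sheared slots, `η_i` on the
partner slots, `−z(η)` at slot `0`. [cite: RudnickSarnak1996, (3.73)] -/
def xiInf (η : Fin k → ℝ) : Fin (k + 1) → ℝ :=
  Fin.cons (-zcoord D P β η) fun i ↦ if i ∈ Didx D then 0 else if i ∈ Aidx D P β then -η (prt D P β i) else η i

variable (D P β) in
/-- The direction `ρ(η)`: `ξ_T = ξ_∞ + L⁻¹ ρ`. [folklore] -/
def rho (η : Fin k → ℝ) : Fin (k + 1) → ℝ :=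
  Fin.cons (-lam D P β η) fun i ↦ if i ∈ Didx D then η i else if i ∈ Aidx D P β then -η i else 0

/-- **`ξ_T(η) = ξ_∞(η) + L⁻¹ ρ(η)`** coordinatewise (`P ⊆ Dᶜ`). [cite: RudnickSarnak1996, (3.69)–(3.72)] -/
theorem xiT_eq_xiInf_add (hP : P ⊆ Finset.univ \ D) (L : ℝ) (η : Fin k → ℝ) (j : Fin (k + 1)) :
    xiT D P β L η j = xiInf D P β η j + L⁻¹ * rho D P β η j := by
  refine Fin.cases ?_ (fun i ↦ ?_) j
  · unfold xiInf rho
    rw [Fin.cons_zero, Fin.cons_zero, xiT_zero hP]; ring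
  · unfold xiInf rho
    rw [Fin.cons_succ, Fin.cons_succ]
    by_cases hD : i ∈ Didx D
    · rw [if_pos hD, if_pos hD, xiT_succ_of_mem_D hP η hD]; ring
    · rw [if_neg hD, if_neg hD]
      by_cases hA : i ∈ Aidx D P β
      · rw [if_pos hA, if_pos hA, xiT_succ_of_mem_A η hA]; ring
      · rw [if_neg hA, if_neg hA, xiT_succ_of_not_mem_A η hA]
        have hU : i ∉ Uidx D P β := by rw [Uidx, Finset.mem_union, not_or]; exact ⟨hD, hA⟩
        unfold cvec; rw [if_neg hU]; ring

/-! ## The weights `W`, `V_T`, `V_∞` -/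

variable (D P β) in
/-- **The kernel weight** `W(η) = Π_{Dη} g₀(η_i) Π_A K(η_a) f₀(λ(η))`, `f₀ = g₀` if `0 ∈ D`, else `K`.
[cite: RudnickSarnak1996, (3.73)] -/
def Wfun (η : Fin k → ℝ) : ℝ := by
  classical
  exact (∏ i ∈ Didx D, g0R (η i)) * (∏ a ∈ Aidx D P β, Kfun (η a)) *
    (if (0 : Fin (k + 1)) ∈ D then g0R (lam D P β η) else Kfun (lam D P β η))

variable (D P β) in
/-- **The pair weights at finite `T`**: `V_T(η) = Π_A η_{prt a} · v⁰_T(η)` with the special weight `1`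
(`0 ∈ D`), `z(η)` (`0 ∈ P`) or `−z(η) − λ(η)/L` (`β p₀ = 0`). [cite: RudnickSarnak1996, (3.72)] -/
def VT (L : ℝ) (η : Fin k → ℝ) : ℝ := by
  classical
  exact (∏ a ∈ Aidx D P β, η (prt D P β a)) *
    (if (0 : Fin (k + 1)) ∈ D then 1 else if (0 : Fin (k + 1)) ∈ P then zcoord D P β η else (-zcoord D P β η - L⁻¹ * lam D P β η))

variable (D P β) in
/-- The limit pair weights `V_∞(η)`. [cite: RudnickSarnak1996, (3.73)] -/
def Vinf (η : Fin k → ℝ) : ℝ := by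
  classical
  exact (∏ a ∈ Aidx D P β, η (prt D P β a)) *
    (if (0 : Fin (k + 1)) ∈ D then 1 else if (0 : Fin (k + 1)) ∈ P then zcoord D P β η else -zcoord D P β η)

/-- **The factor identity in the new variables** (`T ≥ 3`, `P ⊆ Dᶜ`):
`dens(ξ_T) 1_{cell}(ξ_T) Π_{p∈P} A_p(ξ_T) = L^{|P|} 1_{cell}(ξ_T) W(η) V_T(η)`. [cite: RudnickSarnak1996, (3.69)–(3.73)] -/
theorem factor_identity (hP : P ⊆ Finset.univ \ D) {T : ℝ} (hT : 3 ≤ T) (η : Fin k → ℝ) :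
    densR D T (xiT D P β (Real.log T) η) * cellInd D P (xiT D P β (Real.log T) η) *
        ∏ p ∈ P, Afac D P β T (xiT D P β (Real.log T) η) p =
      Real.log T ^ P.card * (cellInd D P (xiT D P β (Real.log T) η) * Wfun D P β η * VT D P β (Real.log T) η) := by
  classical
  set L := Real.log T
  have hL : 0 < L := by have := one_le_log hT; simp only [L]; linarith
  have hLL : L * L⁻¹ = 1 := mul_inv_cancel₀ hL.ne'
  set ξ := xiT D P β L η with hξ
  -- the density factor
  have hdens : densR D T ξ = (∏ i ∈ Didx D, g0R (η i)) * (if (0 : Fin (k + 1)) ∈ D then g0R (lam D P β η) else 1) := by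
    unfold densR
    have hrest : ∏ j ∈ D.erase 0, g0R (Real.log T * ξ j) = ∏ i ∈ Didx D, g0R (η i) := by
      rw [erase_zero_eq_image, Finset.prod_image fun i _ j _ h ↦ Fin.succ_injective _ h]
      refine Finset.prod_congr rfl fun i hi ↦ ?_
      simp only [hξ]
      rw [xiT_succ_of_mem_D hP η hi, ← mul_assoc, hLL, one_mul]
    by_cases h0 : (0 : Fin (k + 1)) ∈ D
    · rw [if_pos h0, ← Finset.mul_prod_erase D _ h0, hrest, mul_comm]
      congr 1
      simp only [hξ]
      rw [xiT_zero hP, zcoord_eq_zero hP h0, sub_zero, show Real.log T * -(L⁻¹ * lam D P β η) = -(L * L⁻¹) * lam D P β η by ring,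
        hLL, neg_one_mul, g0R_neg]
    · rw [if_neg h0, mul_one]
      rw [Finset.erase_eq_of_notMem h0] at hrest
      exact hrest
  -- the sheared pair factors
  have hA : ∀ a ∈ Aidx D P β, Afac D P β T ξ a.succ = L * (η (prt D P β a) * Kfun (η a)) := by
    intro a ha
    unfold Afac
    simp only [hξ]
    rw [← prt_succ D P β ha, xiT_succ_prt η ha, xiT_succ_of_mem_A η ha,
      show Real.log T * (-(L⁻¹ * η a) - η (prt D P β a) + η (prt D P β a)) = -(L * L⁻¹) * η a by ring, hLL,
      neg_one_mul, Kfun_neg]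
    ring
  have hprodA : ∏ a ∈ Aidx D P β, Afac D P β T ξ a.succ =
      L ^ (Aidx D P β).card * ((∏ a ∈ Aidx D P β, η (prt D P β a)) * ∏ a ∈ Aidx D P β, Kfun (η a)) := by
    rw [Finset.prod_congr rfl hA, Finset.prod_mul_distrib, Finset.prod_const, Finset.prod_mul_distrib]
  -- the special pair factor and the card of `P`
  have hspecial : (∏ p ∈ P.filter (fun p ↦ ¬ (p ≠ 0 ∧ betaF D P β p ≠ 0)), Afac D P β T ξ p) =
      L ^ (P.filter (fun p ↦ ¬ (p ≠ 0 ∧ betaF D P β p ≠ 0))).card *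
        (if (0 : Fin (k + 1)) ∈ D then 1 else Kfun (lam D P β η) *
          (if (0 : Fin (k + 1)) ∈ P then zcoord D P β η else (-zcoord D P β η - L⁻¹ * lam D P β η))) := by
    rcases zero_mem_cases hP with ⟨hD, hPn, -⟩ | ⟨hD, hPm, -⟩ | ⟨hD, hPn, hQ⟩
    · rw [filter_special_eq_empty hP hD, Finset.prod_empty, Finset.card_empty, pow_zero, if_pos hD, mul_one]
    · rw [filter_special_eq_of_zero_mem_P hPm, Finset.prod_singleton, Finset.card_singleton, pow_one, if_neg hD, if_pos hPm]
      have hb0 := betaF_ne_zero_of_zero_mem_P (β := β) hPm hPm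
      have hZ : (betaF D P β 0).pred hb0 ∈ Zidx D P β := by rw [Zidx_eq_of_zero_mem_P hPm]; exact Finset.mem_singleton_self _
      unfold Afac
      simp only [hξ]
      rw [show betaF D P β 0 = ((betaF D P β 0).pred hb0).succ by rw [Fin.succ_pred], xiT_succ_of_mem_Z η hZ, xiT_zero hP,
        zcoord_eq_of_zero_mem_P hPm]
      rw [show Real.log T * (-(L⁻¹ * lam D P β η) - η ((betaF D P β 0).pred hb0) + η ((betaF D P β 0).pred hb0)) =
        -(L * L⁻¹) * lam D P β η by ring, hLL, neg_one_mul, Kfun_neg]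
      ring
    · obtain ⟨p₀, hp₀, hb⟩ := exists_betaF_eq D P β hQ
      have hne : p₀ ≠ 0 := fun h ↦ hPn (h ▸ hp₀)
      rw [filter_special_eq_of_betaF_eq_zero hp₀ hb, Finset.prod_singleton, Finset.card_singleton, pow_one, if_neg hD, if_neg hPn]
      have hZ : p₀.pred hne ∈ Zidx D P β := by rw [Zidx_eq_of_betaF_eq_zero hP hp₀ hb hne]; exact Finset.mem_singleton_self _
      unfold Afac
      simp only [hξ]
      rw [hb, show p₀ = (p₀.pred hne).succ by rw [Fin.succ_pred], xiT_succ_of_mem_Z η hZ, xiT_zero hP,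
        zcoord_eq_of_betaF_eq_zero hP hp₀ hb hne]
      rw [show Real.log T * (η (p₀.pred hne) + (-(L⁻¹ * lam D P β η) - η (p₀.pred hne))) = -(L * L⁻¹) * lam D P β η by ring,
        hLL, neg_one_mul, Kfun_neg]
      have e2 : Real.log T * (-(L⁻¹ * lam D P β η) - η (p₀.pred hne)) = L * (-η (p₀.pred hne) - L⁻¹ * lam D P β η) := by
        simp only [L]; ring
      rw [e2]; ring
  have hcardP : P.card = (Aidx D P β).card + (P.filter (fun p ↦ ¬ (p ≠ 0 ∧ betaF D P β p ≠ 0))).card := by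
    rw [card_Aidx, ← Finset.card_filter_add_card_filter_not (fun p ↦ p ≠ 0 ∧ betaF D P β p ≠ 0)]
  -- assemble
  rw [prod_P_split (β := β), hprodA, hspecial, hdens, hcardP, pow_add]
  unfold Wfun VT
  split_ifs <;> ring

/-! ## The scaled main term as `∫ H_T` -/

variable (D P β) in
/-- **The integrand in the new variables** `H_T(η) = Φ(ξ_T(η)) 1_{cell}(ξ_T(η)) W(η) V_T(η)`.
[cite: RudnickSarnak1996, (3.73)] -/
def HT (Φ : (Fin (k + 1) → ℝ) → ℂ) (T : ℝ) (η : Fin k → ℝ) : ℂ :=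
  Φ (xiT D P β (Real.log T) η) * ((cellInd D P (xiT D P β (Real.log T) η) * Wfun D P β η * VT D P β (Real.log T) η : ℝ) : ℂ)

variable (D P β) in
/-- **The limit integrand** `H_∞(η) = Φ(ξ_∞(η)) 1_{cell}(ξ_∞(η)) W(η) V_∞(η)`. [cite: RudnickSarnak1996, (3.73)] -/
def Hinf (Φ : (Fin (k + 1) → ℝ) → ℂ) (η : Fin k → ℝ) : ℂ :=
  Φ (xiInf D P β η) * ((cellInd D P (xiInf D P β η) * Wfun D P β η * Vinf D P β η : ℝ) : ℂ)

/-- **The scaled main term**: for `T ≥ 3` and `P ⊆ Dᶜ`,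
`(L^{|D|}/L) J_{β,∅}(T) = ∫ H_T(η) dη`. [cite: RudnickSarnak1996, (3.69)–(3.73)] -/
theorem scaled_JE_empty_eq (hP : P ⊆ Finset.univ \ D) (Φ : (Fin (k + 1) → ℝ) → ℂ) {T : ℝ} (hT : 3 ≤ T) :
    (((Real.log T ^ D.card / Real.log T : ℝ)) : ℂ) * JE D P β Φ ∅ T = ∫ η : Fin k → ℝ, HT D P β Φ T η := by
  set L := Real.log T
  have hL : 0 < L := by have := one_le_log hT; simp only [L]; linarith
  have hU : (Uidx D P β).card + 1 = D.card + P.card := card_Uidx (β := β) hP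
  unfold JE
  rw [integral_slicePt_eq_integral_xiT (D := D) (P := P) (β := β) hL
    (fun ξ ↦ Φ ξ * ((densR D T ξ * cellInd D P ξ * ((∏ p ∈ (∅ : Finset (Fin (k + 1))), Efac D P β T ξ p) *
      ∏ p ∈ P \ ∅, Afac D P β T ξ p) : ℝ) : ℂ))]
  have hpt : ∀ η : Fin k → ℝ, Φ (xiT D P β L η) * ((densR D T (xiT D P β L η) * cellInd D P (xiT D P β L η) *
      ((∏ p ∈ (∅ : Finset (Fin (k + 1))), Efac D P β T (xiT D P β L η) p) * ∏ p ∈ P \ ∅, Afac D P β T (xiT D P β L η) p) : ℝ) : ℂ) =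
      ((L ^ P.card : ℝ) : ℂ) * HT D P β Φ T η := by
    intro η
    rw [Finset.prod_empty, one_mul, Finset.sdiff_empty, factor_identity hP hT η]
    unfold HT
    push_cast
    ring
  simp_rw [hpt]
  rw [integral_const_mul, Complex.real_smul, ← mul_assoc, ← mul_assoc]
  have hcoef : (((L ^ D.card / L : ℝ)) : ℂ) * (((L ^ (Uidx D P β).card)⁻¹ : ℝ) : ℂ) * ((L ^ P.card : ℝ) : ℂ) = 1 := by
    rw [← Complex.ofReal_mul, ← Complex.ofReal_mul, ← Complex.ofReal_one]
    congr 1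
    have e : L ^ D.card * L ^ P.card = L ^ (Uidx D P β).card * L := by
      rw [← pow_add, ← pow_succ, ← hU]
    field_simp
    linear_combination e
  rw [hcoef, one_mul]

/-! ## Continuity of the new variables and of the weights -/

/-- `η ↦ ξ_T(η)` is continuous. [folklore] -/
theorem continuous_xiT (L : ℝ) : Continuous (xiT D P β L) := by
  unfold xiT
  refine continuous_slicePt'.comp ?_
  refine (LinearMap.continuous_of_finiteDimensional _).comp ?_
  exact continuous_pi fun i ↦ continuous_const.mul (continuous_apply i)

/-- `λ`, `z` are continuous. [folklore] -/
theorem continuous_lam : Continuous (lam D P β) := by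
  unfold lam
  exact (continuous_finsetSum _ fun i _ ↦ continuous_apply i).sub (continuous_finsetSum _ fun i _ ↦ continuous_apply i)

/-- `z` is continuous. [folklore] -/
theorem continuous_zcoord : Continuous (zcoord D P β) := by
  unfold zcoord; exact continuous_finsetSum _ fun i _ ↦ continuous_apply i

/-- `W` is continuous. [folklore] -/
theorem continuous_Wfun : Continuous (Wfun D P β) := by
  classical
  unfold Wfun
  refine Continuous.mul (Continuous.mul ?_ ?_) ?_
  · exact continuous_finsetProd _ fun i _ ↦ contDiff_g0R.continuous.comp (continuous_apply i)
  · exact continuous_finsetProd _ fun a _ ↦ continuous_Kfun.comp (continuous_apply a)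
  · split_ifs
    · exact contDiff_g0R.continuous.comp continuous_lam
    · exact continuous_Kfun.comp continuous_lam

/-- `V_T` is continuous in `η`. [folklore] -/
theorem continuous_VT (L : ℝ) : Continuous (VT D P β L) := by
  classical
  unfold VT
  refine Continuous.mul (continuous_finsetProd _ fun a _ ↦ continuous_apply _) ?_
  split_ifs
  · exact continuous_const
  · exact continuous_zcoord
  · exact continuous_zcoord.neg.sub (continuous_const.mul continuous_lam)

/-- `V_∞` is continuous. [folklore] -/
theorem continuous_Vinf : Continuous (Vinf D P β) := by
  classical
  unfold Vinf
  refine Continuous.mul (continuous_finsetProd _ fun a _ ↦ continuous_apply _) ?_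
  split_ifs
  · exact continuous_const
  · exact continuous_zcoord
  · exact continuous_zcoord.neg

/-- `ξ_∞` is continuous. [folklore] -/
theorem continuous_xiInf : Continuous (xiInf D P β) := by
  unfold xiInf
  refine continuous_pi fun j ↦ ?_
  refine Fin.cases ?_ (fun i ↦ ?_) j
  · simp only [Fin.cons_zero]; exact continuous_zcoord.neg
  · simp only [Fin.cons_succ]
    split_ifs
    · exact continuous_const
    · exact (continuous_apply _).neg
    · exact continuous_apply i

/-- The cell indicator along a continuous reparametrisation is measurable. [folklore] -/
theorem measurable_cellInd_xiT (L : ℝ) : Measurable fun η : Fin k → ℝ ↦ cellInd D P (xiT D P β L η) := by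
  have h : (fun η : Fin k → ℝ ↦ cellInd D P (xiT D P β L η)) =
      (fun η : Fin k → ℝ ↦ cellInd D P (slicePt η)) ∘ (fun η ↦ pairShear (Aidx D P β) (prt D P β) (fun i ↦ cvec D P β L i * η i)) := rfl
  rw [h]
  refine measurable_cellInd.comp (Continuous.measurable ?_)
  exact (LinearMap.continuous_of_finiteDimensional _).comp (continuous_pi fun i ↦ continuous_const.mul (continuous_apply i))

/-- Measurability of the cell indicator at `ξ_∞`. [folklore] -/
theorem measurable_cellInd_xiInf : Measurable fun η : Fin k → ℝ ↦ cellInd D P (xiInf D P β η) := by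
  classical
  unfold cellInd
  refine Measurable.ite ?_ measurable_const measurable_const
  -- the cell through the continuous map `ξ_∞`
  by_cases hPS : P ⊆ Finset.univ \ D
  · have e : {η : Fin k → ℝ | posSide (xiInf D P β η) (Finset.univ \ D) = P} =
        ⋂ j ∈ Finset.univ \ D, {η : Fin k → ℝ | xiInf D P β η j ≤ 0 ↔ j ∈ P} := by
      ext η
      simp only [Set.mem_setOf_eq, Set.mem_iInter]
      unfold posSide
      constructor
      · intro h j hj
        have h2 := Finset.ext_iff.1 h j
        rw [Finset.mem_filter] at h2
        exact ⟨fun h' ↦ h2.1 ⟨hj, h'⟩, fun h' ↦ (h2.2 h').2⟩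
      · intro h
        ext j
        rw [Finset.mem_filter]
        constructor
        · rintro ⟨hj, h'⟩; exact (h j hj).1 h'
        · intro hj; exact ⟨hPS hj, (h j (hPS hj)).2 hj⟩
    rw [e]
    refine Finset.measurableSet_biInter _ fun j _ ↦ ?_
    have hc : Continuous fun η : Fin k → ℝ ↦ xiInf D P β η j := (continuous_apply j).comp continuous_xiInf
    by_cases hj : j ∈ P
    · have : {η : Fin k → ℝ | xiInf D P β η j ≤ 0 ↔ j ∈ P} = {η | xiInf D P β η j ≤ 0} := by ext η; simp [hj]
      rw [this]; exact measurableSet_le hc.measurable measurable_const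
    · have : {η : Fin k → ℝ | xiInf D P β η j ≤ 0 ↔ j ∈ P} = {η | 0 < xiInf D P β η j} := by ext η; simp [hj, not_le]
      rw [this]; exact measurableSet_lt measurable_const hc.measurable
  · have e : {η : Fin k → ℝ | posSide (xiInf D P β η) (Finset.univ \ D) = P} = ∅ := by
      ext η
      simp only [Set.mem_setOf_eq, Set.mem_empty_iff_false, iff_false]
      intro h; exact hPS (h ▸ Finset.filter_subset _ _)
    rw [e]; exact MeasurableSet.empty

/-- `H_T` is measurable (for continuous `Φ`). [folklore] -/
theorem measurable_HT {Φ : (Fin (k + 1) → ℝ) → ℂ} (hΦc : Continuous Φ) (T : ℝ) : Measurable (HT D P β Φ T) := by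
  unfold HT
  refine (hΦc.comp (continuous_xiT _)).measurable.mul (Complex.measurable_ofReal.comp ?_)
  exact ((measurable_cellInd_xiT _).mul continuous_Wfun.measurable).mul (continuous_VT _).measurable

/-! ## Pointwise convergence -/

/-- `(log T)⁻¹ → 0`. [folklore] -/
theorem tendsto_inv_log : Tendsto (fun T : ℝ ↦ (Real.log T)⁻¹) atTop (𝓝 0) :=
  tendsto_inv_atTop_zero.comp Real.tendsto_log_atTop

/-- `ξ_T(η) → ξ_∞(η)`. [cite: RudnickSarnak1996, (3.73)] -/
theorem tendsto_xiT (hP : P ⊆ Finset.univ \ D) (η : Fin k → ℝ) :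
    Tendsto (fun T : ℝ ↦ xiT D P β (Real.log T) η) atTop (𝓝 (xiInf D P β η)) := by
  rw [tendsto_pi_nhds]
  intro j
  have e : (fun T : ℝ ↦ xiT D P β (Real.log T) η j) = fun T ↦ xiInf D P β η j + (Real.log T)⁻¹ * rho D P β η j :=
    funext fun T ↦ xiT_eq_xiInf_add hP _ η j
  rw [e]
  have h := (tendsto_inv_log.mul_const (rho D P β η j)).const_add (xiInf D P β η j)
  simpa using h

/-- `V_T(η) → V_∞(η)`. [folklore] -/
theorem tendsto_VT (η : Fin k → ℝ) : Tendsto (fun T : ℝ ↦ VT D P β (Real.log T) η) atTop (𝓝 (Vinf D P β η)) := by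
  classical
  unfold VT Vinf
  refine Tendsto.mul tendsto_const_nhds ?_
  split_ifs
  · exact tendsto_const_nhds
  · exact tendsto_const_nhds
  · have h := (tendsto_inv_log.mul_const (lam D P β η)).const_sub (-zcoord D P β η)
    simpa using h

/-- The good set: all partner and special coordinates are nonzero. [folklore] -/
def goodSet (D P : Finset (Fin (k + 1))) (β : ↥P ≃ ↥((Finset.univ \ D) \ P)) : Set (Fin k → ℝ) :=
  {η | ∀ i, i ∉ Uidx D P β → η i ≠ 0}

/-- Almost every `η` is good. [folklore] -/
theorem ae_mem_goodSet : ∀ᵐ η : Fin k → ℝ, η ∈ goodSet D P β := by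
  have h : ∀ i : Fin k, ∀ᵐ η : Fin k → ℝ, η i ≠ 0 := fun i ↦ by
    have := MeasureTheory.Measure.ae_eval_ne (fun _ : Fin k ↦ (volume : Measure ℝ)) i (0 : ℝ)
    rwa [← volume_pi] at this
  have h2 : ∀ᵐ η : Fin k → ℝ, ∀ i : Fin k, η i ≠ 0 := ae_all_iff.2 h
  filter_upwards [h2] with η hη
  exact fun i _ ↦ hη i

/-- On the good set the coordinates of `ξ_∞` off `D` are nonzero (`P ⊆ Dᶜ`). [folklore] -/
theorem xiInf_ne_zero (hP : P ⊆ Finset.univ \ D) {η : Fin k → ℝ} (hη : η ∈ goodSet D P β) {j : Fin (k + 1)} (hj : j ∉ D) :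
    xiInf D P β η j ≠ 0 := by
  unfold xiInf
  refine Fin.cases ?_ (fun i hj ↦ ?_) j hj
  · intro h0
    rw [Fin.cons_zero, neg_ne_zero]
    rcases zero_mem_cases hP with ⟨hD, -, -⟩ | ⟨-, hPm, -⟩ | ⟨-, hPn, hQ⟩
    · exact absurd hD h0
    · rw [zcoord_eq_of_zero_mem_P hPm]
      refine hη _ (not_mem_Uidx_of_mem_Zidx ?_)
      rw [Zidx_eq_of_zero_mem_P hPm]; exact Finset.mem_singleton_self _
    · obtain ⟨p₀, hp₀, hb⟩ := exists_betaF_eq D P β hQ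
      have hne : p₀ ≠ 0 := fun h ↦ hPn (h ▸ hp₀)
      rw [zcoord_eq_of_betaF_eq_zero hP hp₀ hb hne]
      refine hη _ (not_mem_Uidx_of_mem_Zidx ?_)
      rw [Zidx_eq_of_betaF_eq_zero hP hp₀ hb hne]; exact Finset.mem_singleton_self _
  · rw [Fin.cons_succ]
    have hD : i ∉ Didx D := fun h ↦ hj (by rw [Didx, Finset.mem_filter] at h; exact h.2)
    rw [if_neg hD]
    by_cases hA : i ∈ Aidx D P β
    · rw [if_pos hA, neg_ne_zero]; exact hη _ (prt_not_mem_Uidx hA)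
    · rw [if_neg hA]
      exact hη _ (by rw [Uidx, Finset.mem_union, not_or]; exact ⟨hD, hA⟩)

/-- **Stabilisation of the cell**: on the good set, eventually `1_{cell}(ξ_T(η)) = 1_{cell}(ξ_∞(η))`. [folklore] -/
theorem eventually_cellInd_eq (hP : P ⊆ Finset.univ \ D) {η : Fin k → ℝ} (hη : η ∈ goodSet D P β) :
    ∀ᶠ T : ℝ in atTop, cellInd D P (xiT D P β (Real.log T) η) = cellInd D P (xiInf D P β η) := by
  classical
  have hsign : ∀ j ∈ Finset.univ \ D, ∀ᶠ T : ℝ in atTop, (xiT D P β (Real.log T) η j ≤ 0 ↔ xiInf D P β η j ≤ 0) := by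
    intro j hj
    have hj' : j ∉ D := (Finset.mem_sdiff.1 hj).2
    have hne := xiInf_ne_zero hP hη hj'
    have ht : Tendsto (fun T : ℝ ↦ xiT D P β (Real.log T) η j) atTop (𝓝 (xiInf D P β η j)) :=
      (continuous_apply j).continuousAt.tendsto.comp (tendsto_xiT hP η)
    rcases lt_or_gt_of_ne hne with hlt | hgt
    · filter_upwards [ht.eventually (gt_mem_nhds hlt)] with T hT
      exact ⟨fun _ ↦ hlt.le, fun _ ↦ hT.le⟩
    · filter_upwards [ht.eventually (lt_mem_nhds hgt)] with T hT
      constructor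
      · intro h; linarith
      · intro h; linarith
  have hall := (Filter.eventually_all_finset (Finset.univ \ D)).2 hsign
  filter_upwards [hall] with T hT
  have hps : posSide (xiT D P β (Real.log T) η) (Finset.univ \ D) = posSide (xiInf D P β η) (Finset.univ \ D) := by
    unfold posSide
    exact Finset.filter_congr fun j hj ↦ hT j hj
  unfold cellInd
  rw [hps]

/-- **Pointwise convergence**: on the good set, `H_T(η) → H_∞(η)` (continuous `Φ`, `P ⊆ Dᶜ`).
[cite: RudnickSarnak1996, (3.73)] -/
theorem tendsto_HT (hP : P ⊆ Finset.univ \ D) {Φ : (Fin (k + 1) → ℝ) → ℂ} (hΦc : Continuous Φ)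
    {η : Fin k → ℝ} (hη : η ∈ goodSet D P β) :
    Tendsto (fun T : ℝ ↦ HT D P β Φ T η) atTop (𝓝 (Hinf D P β Φ η)) := by
  unfold HT Hinf
  refine Tendsto.mul (hΦc.continuousAt.tendsto.comp (tendsto_xiT hP η)) ?_
  refine (Complex.continuous_ofReal.tendsto _).comp ?_
  have h1 : Tendsto (fun T : ℝ ↦ cellInd D P (xiInf D P β η) * Wfun D P β η * VT D P β (Real.log T) η) atTop
      (𝓝 (cellInd D P (xiInf D P β η) * Wfun D P β η * Vinf D P β η)) :=
    (tendsto_const_nhds.mul (tendsto_VT η))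
  refine h1.congr' ?_
  filter_upwards [eventually_cellInd_eq hP hη] with T hT
  rw [hT]

/-! ## Domination -/

variable (D P β) in
/-- The one-dimensional dominating functions: `g₀` on `Dη`, `K` on `A`, `1[|x| ≤ 2]` elsewhere. [folklore] -/
def domU (i : Fin k) (x : ℝ) : ℝ :=
  if i ∈ Didx D then g0R x else if i ∈ Aidx D P β then Kfun x else (if |x| ≤ 2 then 1 else 0)

/-- `domU ≥ 0` and integrable. [folklore] -/
theorem domU_props (i : Fin k) : (∀ x, 0 ≤ domU D P β i x) ∧ Integrable (domU D P β i) := by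
  unfold domU
  split_ifs
  · exact ⟨g0R_nonneg, integrable_g0R⟩
  · exact ⟨Kfun_nonneg, integrable_Kfun⟩
  · exact ⟨fun x ↦ by split_ifs <;> norm_num, integrable_ite_abs_le⟩

/-- The constant of the domination. [folklore] -/
def domConst (k : ℕ) (MΦ : ℝ) : ℝ := MΦ * 2 ^ (k + 1) * (max bumpMass (bumpMass * ker 0))

variable (D P β) in
/-- The dominating function. [folklore] -/
def Dom (MΦ : ℝ) (η : Fin k → ℝ) : ℝ := domConst k MΦ * ∏ i, domU D P β i (η i)

/-- `Dom` is integrable. [folklore] -/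
theorem integrable_Dom (MΦ : ℝ) : Integrable (Dom D P β MΦ) := by
  unfold Dom
  refine Integrable.const_mul ?_ _
  have := Integrable.fintype_prod (f := fun i ↦ domU D P β i) (μ := fun _ ↦ (volume : Measure ℝ)) fun i ↦ (domU_props i).2
  simpa [volume_pi] using this

/-- **Domination**: for `T ≥ 3`, `‖H_T(η)‖ ≤ Dom(η)` (bounded box-supported `Φ`, `P ⊆ Dᶜ`).
[cite: RudnickSarnak1996, (3.73)] -/
theorem norm_HT_le (hP : P ⊆ Finset.univ \ D) {Φ : (Fin (k + 1) → ℝ) → ℂ} {MΦ : ℝ} (hΦb : ∀ ξ, ‖Φ ξ‖ ≤ MΦ)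
    (hΦs : ∀ ξ, Φ ξ ≠ 0 → ∀ j, |ξ j| ≤ 2) {T : ℝ} (hT : 3 ≤ T) (η : Fin k → ℝ) :
    ‖HT D P β Φ T η‖ ≤ Dom D P β MΦ η := by
  classical
  set L := Real.log T
  have hL : 0 < L := by have := one_le_log hT; simp only [L]; linarith
  have hM0 : 0 ≤ MΦ := (norm_nonneg _).trans (hΦb 0)
  have hF0 : 0 ≤ max bumpMass (bumpMass * ker 0) := le_trans bumpMass_pos.le (le_max_left _ _)
  have hdom0 : 0 ≤ Dom D P β MΦ η := by
    unfold Dom domConst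
    exact mul_nonneg (by positivity) (Finset.prod_nonneg fun i _ ↦ (domU_props i).1 _)
  unfold HT
  by_cases hΦ0 : Φ (xiT D P β L η) = 0
  · rw [hΦ0, zero_mul, norm_zero]; exact hdom0
  have hbox := hΦs _ hΦ0
  set ξ := xiT D P β L η with hξ
  -- the coordinates off `U` are box coordinates
  have hoffU : ∀ i, i ∉ Uidx D P β → |η i| ≤ 2 := by
    intro i hi
    have hA : i ∉ Aidx D P β := fun h ↦ hi (Finset.mem_union_right _ h)
    have h := hbox i.succ
    simp only [hξ] at h
    rw [xiT_succ_of_not_mem_A η hA] at h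
    unfold cvec at h
    rwa [if_neg hi, one_mul] at h
  -- bound for `W`
  have hW : |Wfun D P β η| ≤ (∏ i ∈ Didx D, g0R (η i)) * (∏ a ∈ Aidx D P β, Kfun (η a)) * (max bumpMass (bumpMass * ker 0)) := by
    unfold Wfun
    rw [abs_mul, abs_mul, abs_of_nonneg (Finset.prod_nonneg fun _ _ ↦ g0R_nonneg _),
      abs_of_nonneg (Finset.prod_nonneg fun _ _ ↦ Kfun_nonneg _)]
    refine mul_le_mul_of_nonneg_left ?_ (mul_nonneg (Finset.prod_nonneg fun _ _ ↦ g0R_nonneg _) (Finset.prod_nonneg fun _ _ ↦ Kfun_nonneg _))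
    split_ifs
    · rw [abs_of_nonneg (g0R_nonneg _)]; exact (g0R_le _).trans (le_max_left _ _)
    · rw [abs_of_nonneg (Kfun_nonneg _)]; exact (Kfun_le _).trans (le_max_right _ _)
  -- bound for `V_T`
  have hV : |VT D P β L η| ≤ 2 ^ (k + 1) := by
    unfold VT
    rw [abs_mul, Finset.abs_prod]
    have h1 : ∏ a ∈ Aidx D P β, |η (prt D P β a)| ≤ 2 ^ (Aidx D P β).card := by
      rw [← Finset.prod_const]
      exact Finset.prod_le_prod (fun a _ ↦ abs_nonneg _) fun a ha ↦ hoffU _ (prt_not_mem_Uidx ha)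
    have h2 : |(if (0 : Fin (k + 1)) ∈ D then (1 : ℝ) else if (0 : Fin (k + 1)) ∈ P then zcoord D P β η else
        (-zcoord D P β η - L⁻¹ * lam D P β η))| ≤ 2 := by
      rcases zero_mem_cases hP with ⟨hD, -, -⟩ | ⟨hD, hPm, -⟩ | ⟨hD, hPn, hQ⟩
      · rw [if_pos hD, abs_one]; norm_num
      · rw [if_neg hD, if_pos hPm, zcoord_eq_of_zero_mem_P hPm]
        refine hoffU _ (not_mem_Uidx_of_mem_Zidx ?_)
        rw [Zidx_eq_of_zero_mem_P hPm]; exact Finset.mem_singleton_self _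
      · rw [if_neg hD, if_neg hPn]
        have h0 := hbox 0
        simp only [hξ] at h0
        rw [xiT_zero hP] at h0
        rwa [show -zcoord D P β η - L⁻¹ * lam D P β η = -(L⁻¹ * lam D P β η) - zcoord D P β η by ring]
    have hcard : (Aidx D P β).card ≤ k := by have := (Aidx D P β).card_le_univ; rwa [Fintype.card_fin] at this
    calc (∏ a ∈ Aidx D P β, |η (prt D P β a)|) * |(if (0 : Fin (k + 1)) ∈ D then (1 : ℝ) else if (0 : Fin (k + 1)) ∈ P then zcoord D P β η else
          (-zcoord D P β η - L⁻¹ * lam D P β η))|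
        ≤ 2 ^ (Aidx D P β).card * 2 := mul_le_mul h1 h2 (abs_nonneg _) (by positivity)
      _ = 2 ^ ((Aidx D P β).card + 1) := by rw [pow_succ]
      _ ≤ 2 ^ (k + 1) := pow_le_pow_right₀ (by norm_num) (by omega)
  -- the product of the dominating functions
  have hprod : ∏ i, domU D P β i (η i) = (∏ i ∈ Didx D, g0R (η i)) * ∏ a ∈ Aidx D P β, Kfun (η a) := by
    unfold domU
    rw [Finset.prod_ite, Finset.filter_mem_eq_inter, Finset.univ_inter, Finset.prod_ite]
    have hA : (Finset.univ.filter fun i ↦ i ∉ Didx D).filter (fun i ↦ i ∈ Aidx D P β) = Aidx D P β := by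
      ext i
      simp only [Finset.mem_filter, Finset.mem_univ, true_and]
      constructor
      · exact fun h ↦ h.2
      · exact fun h ↦ ⟨Finset.disjoint_right.1 (disjoint_Didx_Aidx (β := β) hP) h, h⟩
    have hrest : ∏ i ∈ (Finset.univ.filter fun i ↦ i ∉ Didx D).filter (fun i ↦ i ∉ Aidx D P β), (if |η i| ≤ 2 then (1 : ℝ) else 0) = 1 := by
      refine Finset.prod_eq_one fun i hi ↦ ?_
      simp only [Finset.mem_filter, Finset.mem_univ, true_and] at hi
      rw [if_pos (hoffU i (by rw [Uidx, Finset.mem_union, not_or]; exact hi))]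
    rw [hA, hrest, mul_one]
  -- assemble
  rw [norm_mul, Complex.norm_real, Real.norm_eq_abs, abs_mul, abs_mul]
  unfold Dom domConst
  rw [hprod]
  obtain ⟨hc0, hc1⟩ := cellInd_mem (D := D) (P := P) ξ
  have hDA0 : 0 ≤ (∏ i ∈ Didx D, g0R (η i)) * ∏ a ∈ Aidx D P β, Kfun (η a) :=
    mul_nonneg (Finset.prod_nonneg fun _ _ ↦ g0R_nonneg _) (Finset.prod_nonneg fun _ _ ↦ Kfun_nonneg _)
  calc ‖Φ ξ‖ * (|cellInd D P ξ| * |Wfun D P β η| * |VT D P β L η|)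
      ≤ MΦ * (1 * ((∏ i ∈ Didx D, g0R (η i)) * (∏ a ∈ Aidx D P β, Kfun (η a)) * (max bumpMass (bumpMass * ker 0))) * 2 ^ (k + 1)) := by
        refine mul_le_mul (hΦb ξ) (mul_le_mul (mul_le_mul (by rw [abs_of_nonneg hc0]; exact hc1) hW (abs_nonneg _) zero_le_one)
          hV (abs_nonneg _) (by positivity)) (by positivity) hM0
    _ = MΦ * 2 ^ (k + 1) * (max bumpMass (bumpMass * ker 0)) * ((∏ i ∈ Didx D, g0R (η i)) * ∏ a ∈ Aidx D P β, Kfun (η a)) := by ring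

/-! ## Dominated convergence -/

/-- **`∫ H_T → ∫ H_∞`** (continuous bounded box-supported `Φ`, `P ⊆ Dᶜ`). [cite: RudnickSarnak1996, (3.73)–(3.74)] -/
theorem tendsto_integral_HT (hP : P ⊆ Finset.univ \ D) {Φ : (Fin (k + 1) → ℝ) → ℂ} {MΦ : ℝ} (hΦc : Continuous Φ)
    (hΦb : ∀ ξ, ‖Φ ξ‖ ≤ MΦ) (hΦs : ∀ ξ, Φ ξ ≠ 0 → ∀ j, |ξ j| ≤ 2) :
    Tendsto (fun T : ℝ ↦ ∫ η : Fin k → ℝ, HT D P β Φ T η) atTop (𝓝 (∫ η : Fin k → ℝ, Hinf D P β Φ η)) := by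
  refine tendsto_integral_filter_of_dominated_convergence (Dom D P β MΦ) ?_ ?_ (integrable_Dom MΦ) ?_
  · exact Eventually.of_forall fun T ↦ (measurable_HT hΦc T).aestronglyMeasurable
  · filter_upwards [eventually_ge_atTop (3 : ℝ)] with T hT
    exact Eventually.of_forall fun η ↦ norm_HT_le hP hΦb hΦs hT η
  · filter_upwards [ae_mem_goodSet (D := D) (P := P) (β := β)] with η hη
    exact tendsto_HT hP hΦc hη

/-! ## The limit integral splits: `∫ H_∞ = c_n · I_β` -/

variable (D P β) in
/-- Extension by zero on `U` of a function of the free coordinates. [folklore] -/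
def extOff (y : {i // i ∉ Uidx D P β} → ℝ) : Fin k → ℝ := fun i ↦ if h : i ∈ Uidx D P β then 0 else y ⟨i, h⟩

variable (D P β) in
/-- Extension by zero off `U` of a function of the dilated coordinates. [folklore] -/
def extOn (x : {i // i ∈ Uidx D P β} → ℝ) : Fin k → ℝ := fun i ↦ if h : i ∈ Uidx D P β then x ⟨i, h⟩ else 0

variable (D P β) in
/-- **The pair integral of the pattern**: `I_β(Φ) = ∫ Φ(ξ_∞) 1_{cell}(ξ_∞) V_∞` over the free coordinates.
[cite: RudnickSarnak1996, (3.74)] -/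
def pairInt (Φ : (Fin (k + 1) → ℝ) → ℂ) : ℂ :=
  ∫ y : {i // i ∉ Uidx D P β} → ℝ, Φ (xiInf D P β (extOff D P β y)) *
    ((cellInd D P (xiInf D P β (extOff D P β y)) * Vinf D P β (extOff D P β y) : ℝ) : ℂ)

variable (D P β) in
/-- The kernel weight as a function of the dilated coordinates. [folklore] -/
def WU (x : {i // i ∈ Uidx D P β} → ℝ) : ℝ := Wfun D P β (extOn D P β x)

/-- `ξ_∞` only depends on the coordinates off `U` (`P ⊆ Dᶜ`). [folklore] -/
theorem xiInf_congr {η η' : Fin k → ℝ} (h : ∀ i, i ∉ Uidx D P β → η i = η' i) :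
    xiInf D P β η = xiInf D P β η' := by
  have hz : zcoord D P β η = zcoord D P β η' := by
    unfold zcoord; exact Finset.sum_congr rfl fun i hi ↦ h i (not_mem_Uidx_of_mem_Zidx hi)
  unfold xiInf
  rw [hz]
  congr 1
  funext i
  split_ifs with hD hA
  · rfl
  · rw [h _ (prt_not_mem_Uidx hA)]
  · exact h i (by rw [Uidx, Finset.mem_union, not_or]; exact ⟨hD, hA⟩)

/-- `V_∞` only depends on the coordinates off `U`. [folklore] -/
theorem Vinf_congr {η η' : Fin k → ℝ} (h : ∀ i, i ∉ Uidx D P β → η i = η' i) :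
    Vinf D P β η = Vinf D P β η' := by
  classical
  have hz : zcoord D P β η = zcoord D P β η' := by
    unfold zcoord; exact Finset.sum_congr rfl fun i hi ↦ h i (not_mem_Uidx_of_mem_Zidx hi)
  unfold Vinf
  rw [hz, Finset.prod_congr rfl fun a ha ↦ h _ (prt_not_mem_Uidx ha)]

/-- `W` only depends on the coordinates in `U`. [folklore] -/
theorem Wfun_congr {η η' : Fin k → ℝ} (h : ∀ i, i ∈ Uidx D P β → η i = η' i) : Wfun D P β η = Wfun D P β η' := by
  classical
  have hl : lam D P β η = lam D P β η' := by
    unfold lam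
    rw [Finset.sum_congr rfl fun i hi ↦ h i (Finset.mem_union_left _ hi),
      Finset.sum_congr rfl fun i hi ↦ h i (Finset.mem_union_right _ hi)]
  have h1 : ∏ i ∈ Didx D, g0R (η i) = ∏ i ∈ Didx D, g0R (η' i) :=
    Finset.prod_congr rfl fun i hi ↦ by rw [h i (Finset.mem_union_left _ hi)]
  have h2 : ∏ a ∈ Aidx D P β, Kfun (η a) = ∏ a ∈ Aidx D P β, Kfun (η' a) :=
    Finset.prod_congr rfl fun i hi ↦ by rw [h i (Finset.mem_union_right _ hi)]
  unfold Wfun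
  rw [hl, h1, h2]

/-- **Splitting `H_∞`**: `H_∞(η) = G(η|_{Uᶜ}) · W(η|_U)`. [folklore] -/
theorem Hinf_eq_mul (Φ : (Fin (k + 1) → ℝ) → ℂ) (η : Fin k → ℝ) :
    Hinf D P β Φ η = ((WU D P β (fun i ↦ η i) : ℝ) : ℂ) *
      (Φ (xiInf D P β (extOff D P β (fun i ↦ η i))) *
        ((cellInd D P (xiInf D P β (extOff D P β (fun i ↦ η i))) * Vinf D P β (extOff D P β (fun i ↦ η i)) : ℝ) : ℂ)) := by
  have hoff : ∀ i, i ∉ Uidx D P β → extOff D P β (fun i : {i // i ∉ Uidx D P β} ↦ η i) i = η i := fun i hi ↦ by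
    unfold extOff; rw [dif_neg hi]
  have hon : ∀ i, i ∈ Uidx D P β → extOn D P β (fun i : {i // i ∈ Uidx D P β} ↦ η i) i = η i := fun i hi ↦ by
    unfold extOn; rw [dif_pos hi]
  unfold Hinf WU
  rw [xiInf_congr hoff, Vinf_congr hoff, Wfun_congr hon]
  push_cast
  ring

/-- **`∫ H_∞ = (∫_U W) · I_β`.** [folklore] -/
theorem integral_Hinf_eq (Φ : (Fin (k + 1) → ℝ) → ℂ) :
    ∫ η : Fin k → ℝ, Hinf D P β Φ η = ((∫ x : {i // i ∈ Uidx D P β} → ℝ, WU D P β x : ℝ) : ℂ) * pairInt D P β Φ := by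
  simp_rw [Hinf_eq_mul (β := β) Φ]
  rw [integral_mul_split (fun i ↦ i ∈ Uidx D P β) (fun x ↦ ((WU D P β x : ℝ) : ℂ))
    (fun y ↦ Φ (xiInf D P β (extOff D P β y)) * ((cellInd D P (xiInf D P β (extOff D P β y)) * Vinf D P β (extOff D P β y) : ℝ) : ℂ))]
  rw [integral_complex_ofReal]
  unfold pairInt
  congr
  exact Subsingleton.elim _ _

/-! ## The dilated integral is the level constant -/

variable (D P β) in
/-- The slot types of the dilated coordinates (`K` on `A`, `g₀` on `Dη`) and their signs in `λ`. [folklore] -/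
def isKU (u : {i // i ∈ Uidx D P β}) : Bool := decide ((u : Fin k) ∈ Aidx D P β)

variable (D P β) in
/-- The sign of a dilated coordinate in `λ`. [folklore] -/
def sgnU (u : {i // i ∈ Uidx D P β}) : ℝ := if (u : Fin k) ∈ Didx D then 1 else -1

/-- **`W` in the dilated coordinates is a product of slot kernels.** [folklore] -/
theorem WU_eq (hP : P ⊆ Finset.univ \ D) (x : {i // i ∈ Uidx D P β} → ℝ) :
    WU D P β x = (∏ u, slotKer (isKU D P β u) (x u)) * slotKer (decide ((0 : Fin (k + 1)) ∉ D)) (∑ u, sgnU D P β u * x u) := by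
  classical
  have hmemU : ∀ i, i ∈ Uidx D P β ↔ i ∈ Didx D ∨ i ∈ Aidx D P β := fun i ↦ by rw [Uidx, Finset.mem_union]
  -- products and sums over the subtype as over the finset
  have hprod : ∏ u, slotKer (isKU D P β u) (x u) = ∏ i ∈ Uidx D P β, slotKer (decide (i ∈ Aidx D P β)) (extOn D P β x i) := by
    rw [← Finset.prod_coe_sort (Uidx D P β)]
    refine Finset.prod_congr rfl fun u _ ↦ ?_
    unfold isKU extOn
    rw [dif_pos u.2]
  have hsum : ∑ u, sgnU D P β u * x u = ∑ i ∈ Uidx D P β, (if i ∈ Didx D then (1 : ℝ) else -1) * extOn D P β x i := by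
    rw [← Finset.sum_coe_sort (Uidx D P β)]
    refine Finset.sum_congr rfl fun u _ ↦ ?_
    unfold sgnU extOn
    rw [dif_pos u.2]
  rw [hprod, hsum, Uidx, Finset.prod_union (disjoint_Didx_Aidx hP), Finset.sum_union (disjoint_Didx_Aidx hP)]
  have hD : ∏ i ∈ Didx D, slotKer (decide (i ∈ Aidx D P β)) (extOn D P β x i) = ∏ i ∈ Didx D, g0R (extOn D P β x i) := by
    refine Finset.prod_congr rfl fun i hi ↦ ?_
    have : i ∉ Aidx D P β := Finset.disjoint_left.1 (disjoint_Didx_Aidx (β := β) hP) hi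
    simp [slotKer, this]
  have hA : ∏ i ∈ Aidx D P β, slotKer (decide (i ∈ Aidx D P β)) (extOn D P β x i) = ∏ i ∈ Aidx D P β, Kfun (extOn D P β x i) := by
    refine Finset.prod_congr rfl fun i hi ↦ ?_
    simp [slotKer, hi]
  have hsD : ∑ i ∈ Didx D, (if i ∈ Didx D then (1 : ℝ) else -1) * extOn D P β x i = ∑ i ∈ Didx D, extOn D P β x i :=
    Finset.sum_congr rfl fun i hi ↦ by rw [if_pos hi, one_mul]
  have hsA : ∑ i ∈ Aidx D P β, (if i ∈ Didx D then (1 : ℝ) else -1) * extOn D P β x i = -∑ i ∈ Aidx D P β, extOn D P β x i := by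
    rw [← Finset.sum_neg_distrib]
    refine Finset.sum_congr rfl fun i hi ↦ ?_
    have : i ∉ Didx D := Finset.disjoint_right.1 (disjoint_Didx_Aidx (β := β) hP) hi
    rw [if_neg this]; ring
  rw [hD, hA, hsD, hsA, ← sub_eq_add_neg]
  unfold WU Wfun lam
  by_cases h0 : (0 : Fin (k + 1)) ∈ D
  · simp [slotKer, h0]
  · simp [slotKer, h0]

/-- The weights add up to the level: `Σ_u wt_u + wt₀ = n`. [folklore] -/
theorem sum_slotWt_eq (hP : P ⊆ Finset.univ \ D) :
    ∑ u : {i // i ∈ Uidx D P β}, slotWt (isKU D P β u) + slotWt (decide ((0 : Fin (k + 1)) ∉ D)) = k + 1 := by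
  classical
  have hsum : ∑ u : {i // i ∈ Uidx D P β}, slotWt (isKU D P β u) = (Didx D).card + 2 * (Aidx D P β).card := by
    have e : ∑ u : {i // i ∈ Uidx D P β}, slotWt (isKU D P β u) = ∑ i ∈ Uidx D P β, (if i ∈ Aidx D P β then 2 else 1) := by
      rw [← Finset.sum_coe_sort (Uidx D P β)]
      refine Finset.sum_congr rfl fun u _ ↦ ?_
      unfold isKU slotWt
      by_cases h : (u : Fin k) ∈ Aidx D P β <;> simp [h]
    rw [e, Uidx, Finset.sum_union (disjoint_Didx_Aidx hP)]
    rw [Finset.sum_congr rfl fun i hi ↦ if_neg (Finset.disjoint_left.1 (disjoint_Didx_Aidx (β := β) hP) hi),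
      Finset.sum_congr rfl fun i hi ↦ if_pos hi, Finset.sum_const, Finset.sum_const]
    simp [mul_comm]
  rw [hsum]
  -- `|P| = |Q|`, `|D| + |P| + |Q| = k + 1`
  have hPQ : P.card = ((Finset.univ \ D) \ P).card := by
    have := Fintype.card_congr β
    simp only [Fintype.card_coe] at this
    exact this
  have hDPQ : D.card + (P.card + ((Finset.univ \ D) \ P).card) = k + 1 := by
    rw [← Finset.card_union_of_disjoint Finset.disjoint_sdiff, Finset.union_sdiff_of_subset hP,
      ← Finset.card_union_of_disjoint Finset.disjoint_sdiff, Finset.union_sdiff_of_subset (Finset.subset_univ D),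
      Finset.card_univ, Fintype.card_fin]
  rw [card_Didx, card_Aidx]
  rcases zero_mem_cases hP with ⟨hD, hPn, -⟩ | ⟨hD, hPm, -⟩ | ⟨hD, hPn, hQ⟩
  · rw [Finset.card_erase_of_mem hD]
    have hf : P.filter (fun p ↦ p ≠ 0 ∧ betaF D P β p ≠ 0) = P :=
      Finset.filter_true_of_mem fun p hp ↦ ⟨fun h ↦ hPn (h ▸ hp), betaF_ne_zero_of_zero_mem_D hD hp⟩
    rw [hf]
    simp only [hD, not_true_eq_false, decide_false, slotWt, Bool.false_eq_true, if_false]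
    have := Finset.card_pos.2 ⟨0, hD⟩
    omega
  · rw [Finset.erase_eq_of_notMem hD]
    have hf : P.filter (fun p ↦ p ≠ 0 ∧ betaF D P β p ≠ 0) = P.erase 0 := by
      ext p
      simp only [Finset.mem_filter, Finset.mem_erase]
      constructor
      · rintro ⟨hp, hne, -⟩; exact ⟨hne, hp⟩
      · rintro ⟨hne, hp⟩; exact ⟨hp, hne, betaF_ne_zero_of_zero_mem_P hPm hp⟩
    rw [hf, Finset.card_erase_of_mem hPm]
    simp only [hD, not_false_eq_true, decide_true, slotWt, if_true]
    have := Finset.card_pos.2 ⟨0, hPm⟩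
    omega
  · rw [Finset.erase_eq_of_notMem hD]
    obtain ⟨p₀, hp₀, hb⟩ := exists_betaF_eq D P β hQ
    have hf : P.filter (fun p ↦ p ≠ 0 ∧ betaF D P β p ≠ 0) = P.erase p₀ := by
      ext p
      simp only [Finset.mem_filter, Finset.mem_erase]
      constructor
      · rintro ⟨hp, -, hne⟩; exact ⟨fun h ↦ hne (h ▸ hb), hp⟩
      · rintro ⟨hne, hp⟩
        refine ⟨hp, fun h ↦ hPn (h ▸ hp), fun h ↦ hne ?_⟩
        exact betaF_injOn D P β (Finset.mem_coe.2 hp) (Finset.mem_coe.2 hp₀) (h.trans hb.symm)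
    rw [hf, Finset.card_erase_of_mem hp₀]
    simp only [hD, not_false_eq_true, decide_true, slotWt, if_true]
    have := Finset.card_pos.2 ⟨p₀, hp₀⟩
    omega

/-- **`∫_U W = c_n`.** [cite: RudnickSarnak1996, (3.74)] -/
theorem integral_WU (hP : P ⊆ Finset.univ \ D) : ∫ x : {i // i ∈ Uidx D P β} → ℝ, WU D P β x = levelConst (k + 1) := by
  classical
  set m := (Uidx D P β).card
  set f : Fin m ≃ {i // i ∈ Uidx D P β} := (Uidx D P β).equivFin.symm
  have hmp := volume_measurePreserving_piCongrLeft (fun _ : {i // i ∈ Uidx D P β} ↦ ℝ) f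
  have h := hmp.integral_comp (MeasurableEquiv.measurableEmbedding _) (WU D P β)
  rw [← h]
  have e : ∀ y : Fin m → ℝ, WU D P β ((MeasurableEquiv.piCongrLeft (fun _ : {i // i ∈ Uidx D P β} ↦ ℝ) f) y) =
      (∏ j, slotKer (isKU D P β (f j)) (y j)) * slotKer (decide ((0 : Fin (k + 1)) ∉ D)) (∑ j, sgnU D P β (f j) * y j) := by
    intro y
    rw [WU_eq hP]
    have happ : ∀ j, (MeasurableEquiv.piCongrLeft (fun _ : {i // i ∈ Uidx D P β} ↦ ℝ) f) y (f j) = y j :=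
      fun j ↦ MeasurableEquiv.piCongrLeft_apply_apply (β := fun _ ↦ ℝ) f y j
    congr 1
    · exact (Fintype.prod_equiv f _ _ fun j ↦ by rw [happ]).symm
    · congr 1
      exact (Fintype.sum_equiv f _ _ fun j ↦ by rw [happ]).symm
  simp_rw [e]
  rw [integral_prod_slotKer_eq_levelConst (fun j ↦ isKU D P β (f j)) (decide ((0 : Fin (k + 1)) ∉ D)) (fun j ↦ sgnU D P β (f j))
    fun j ↦ by unfold sgnU; split_ifs <;> simp]
  congr 1
  have hs : ∑ i, slotWt (isKU D P β (f i)) = ∑ u, slotWt (isKU D P β u) := Fintype.sum_equiv f _ _ fun j ↦ rfl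
  rw [hs]
  exact sum_slotWt_eq hP

/-- **`∫ H_∞ = c_n · I_β(Φ)`.** [cite: RudnickSarnak1996, (3.74)] -/
theorem integral_Hinf (hP : P ⊆ Finset.univ \ D) (Φ : (Fin (k + 1) → ℝ) → ℂ) :
    ∫ η : Fin k → ℝ, Hinf D P β Φ η = (levelConst (k + 1) : ℂ) * pairInt D P β Φ := by
  rw [integral_Hinf_eq (β := β), integral_WU hP]

/-! ## The limits of the scaled cell integrals -/

/-- A continuous bounded box-supported `Φ` is integrable along the slice. [folklore] -/
theorem integrable_phi_slicePt {Φ : (Fin (k + 1) → ℝ) → ℂ} {MΦ : ℝ} (hΦc : Continuous Φ) (hΦb : ∀ ξ, ‖Φ ξ‖ ≤ MΦ)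
    (hΦs : ∀ ξ, Φ ξ ≠ 0 → ∀ j, |ξ j| ≤ 2) : Integrable fun η : Fin k → ℝ ↦ Φ (slicePt η) := by
  classical
  set Bx : Set (Fin k → ℝ) := Set.Icc (fun _ ↦ (-2 : ℝ)) (fun _ ↦ 2)
  have hBx : volume Bx < ⊤ := by
    simp only [Bx]; rw [Real.volume_Icc_pi]; exact ENNReal.prod_lt_top fun i _ ↦ ENNReal.ofReal_lt_top
  have hg : Integrable (fun η : Fin k → ℝ ↦ Bx.indicator (fun _ ↦ MΦ) η) :=
    (integrable_indicator_iff measurableSet_Icc).2 (integrableOn_const hBx.ne)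
  refine hg.mono' (hΦc.comp continuous_slicePt').aestronglyMeasurable (Eventually.of_forall fun η ↦ ?_)
  rw [Set.indicator_apply]
  split_ifs with hη
  · exact hΦb _
  · have hΦ0 : Φ (slicePt η) = 0 := by
      by_contra h
      apply hη
      have hb := hΦs _ h
      simp only [Bx, Set.mem_Icc]
      constructor <;> intro i
      · have := hb i.succ; unfold slicePt at this; rw [Fin.cons_succ] at this; exact (abs_le.1 this).1
      · have := hb i.succ; unfold slicePt at this; rw [Fin.cons_succ] at this; exact (abs_le.1 this).2
    simp only [hΦ0, norm_zero, le_refl]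

/-- **The main term**: `(L^{|D|}/L) J_{β,∅}(T) → c_n I_β(Φ)`. [cite: RudnickSarnak1996, (3.73)–(3.74)] -/
theorem tendsto_scaled_JE_empty (hP : P ⊆ Finset.univ \ D) {Φ : (Fin (k + 1) → ℝ) → ℂ} {MΦ : ℝ} (hΦc : Continuous Φ)
    (hΦb : ∀ ξ, ‖Φ ξ‖ ≤ MΦ) (hΦs : ∀ ξ, Φ ξ ≠ 0 → ∀ j, |ξ j| ≤ 2) :
    Tendsto (fun T : ℝ ↦ (((Real.log T ^ D.card / Real.log T : ℝ)) : ℂ) * JE D P β Φ ∅ T) atTop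
      (𝓝 ((levelConst (k + 1) : ℂ) * pairInt D P β Φ)) := by
  rw [← integral_Hinf hP Φ]
  refine (tendsto_integral_HT hP hΦc hΦb hΦs).congr' ?_
  filter_upwards [eventually_ge_atTop (3 : ℝ)] with T hT
  exact (scaled_JE_empty_eq hP Φ hT).symm

/-- **The error terms**: `(L^{|D|}/L) J_{β,E'}(T) → 0` for `∅ ≠ E' ⊆ P`. [cite: RudnickSarnak1996, (3.68)–(3.73)] -/
theorem tendsto_scaled_JE_of_nonempty (hP : P ⊆ Finset.univ \ D) {Φ : (Fin (k + 1) → ℝ) → ℂ} {MΦ : ℝ}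
    (hΦb : ∀ ξ, ‖Φ ξ‖ ≤ MΦ) (hΦs : ∀ ξ, Φ ξ ≠ 0 → ∀ j, |ξ j| ≤ 2) {E' : Finset (Fin (k + 1))} (hE' : E' ⊆ P)
    (hne : E'.Nonempty) :
    Tendsto (fun T : ℝ ↦ (((Real.log T ^ D.card / Real.log T : ℝ)) : ℂ) * JE D P β Φ E' T) atTop (𝓝 0) := by
  have hM0 : 0 ≤ MΦ := (norm_nonneg _).trans (hΦb 0)
  have hC := errConst_nonneg k
  have hbound : ∀ᶠ T : ℝ in atTop, ‖(((Real.log T ^ D.card / Real.log T : ℝ)) : ℂ) * JE D P β Φ E' T‖ ≤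
      errConst k * MΦ * (Real.log T)⁻¹ := by
    filter_upwards [eventually_ge_atTop (3 : ℝ)] with T hT
    set L := Real.log T
    have hL := one_le_log hT
    have hL0 : 0 < L := by simp only [L]; linarith
    set d := D.card
    set e := E'.card
    have he : 1 ≤ e := Finset.card_pos.2 hne
    have h := norm_JE_mul_pow_le (β := β) hP hΦb hΦs hT hE'
    rw [norm_mul, Complex.norm_real, Real.norm_eq_abs, abs_of_nonneg (by positivity)]
    -- `(L^d/L) ‖J‖ = ‖J‖ L^{d+e} / L^{e+1} ≤ C M L / L^{e+1} ≤ C M / L`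
    have e1 : L ^ d / L * ‖JE D P β Φ E' T‖ = ‖JE D P β Φ E' T‖ * L ^ (d + e) / L ^ (e + 1) := by
      rw [pow_add, pow_succ]; field_simp
    rw [e1, div_le_iff₀ (by positivity)]
    have h2 : L ≤ L⁻¹ * L ^ (e + 1) := by
      rw [pow_succ', ← mul_assoc, inv_mul_cancel₀ hL0.ne', one_mul]
      calc L = L ^ 1 := (pow_one L).symm
        _ ≤ L ^ e := pow_le_pow_right₀ hL he
    calc ‖JE D P β Φ E' T‖ * L ^ (d + e) ≤ errConst k * MΦ * L := h
      _ ≤ errConst k * MΦ * (L⁻¹ * L ^ (e + 1)) := mul_le_mul_of_nonneg_left h2 (by positivity)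
      _ = errConst k * MΦ * L⁻¹ * L ^ (e + 1) := by ring
  refine squeeze_zero_norm' hbound ?_
  have := (tendsto_inv_log).const_mul (errConst k * MΦ)
  simpa using this

/-- **The `β` cell integral**: `(L^{|D|}/L) J_β(T) → c_n I_β(Φ)`. [cite: RudnickSarnak1996, (3.65)–(3.74)] -/
theorem tendsto_scaled_Jbeta (hP : P ⊆ Finset.univ \ D) {Φ : (Fin (k + 1) → ℝ) → ℂ} {MΦ : ℝ} (hΦc : Continuous Φ)
    (hΦb : ∀ ξ, ‖Φ ξ‖ ≤ MΦ) (hΦs : ∀ ξ, Φ ξ ≠ 0 → ∀ j, |ξ j| ≤ 2) :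
    Tendsto (fun T : ℝ ↦ (((Real.log T ^ D.card / Real.log T : ℝ)) : ℂ) * Jbeta D P β Φ T) atTop
      (𝓝 ((levelConst (k + 1) : ℂ) * pairInt D P β Φ)) := by
  classical
  have hΦi := integrable_phi_slicePt hΦc hΦb hΦs
  have hdecomp : ∀ᶠ T : ℝ in atTop, (((Real.log T ^ D.card / Real.log T : ℝ)) : ℂ) * Jbeta D P β Φ T =
      (((Real.log T ^ D.card / Real.log T : ℝ)) : ℂ) * JE D P β Φ ∅ T +
        ∑ E' ∈ P.powerset.erase ∅, (((Real.log T ^ D.card / Real.log T : ℝ)) : ℂ) * JE D P β Φ E' T := by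
    filter_upwards [eventually_ge_atTop (1 : ℝ)] with T hT
    rw [Jbeta_eq_sum_JE hΦi hΦs hT, ← Finset.add_sum_erase _ _ (Finset.empty_mem_powerset P), mul_add, Finset.mul_sum]
  have hlim : Tendsto (fun T : ℝ ↦ (((Real.log T ^ D.card / Real.log T : ℝ)) : ℂ) * JE D P β Φ ∅ T +
      ∑ E' ∈ P.powerset.erase ∅, (((Real.log T ^ D.card / Real.log T : ℝ)) : ℂ) * JE D P β Φ E' T) atTop
      (𝓝 ((levelConst (k + 1) : ℂ) * pairInt D P β Φ + 0)) := by
    refine (tendsto_scaled_JE_empty hP hΦc hΦb hΦs).add ?_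
    rw [show (0 : ℂ) = ∑ E' ∈ P.powerset.erase ∅, (0 : ℂ) by rw [Finset.sum_const_zero]]
    refine tendsto_finsetSum _ fun E' hE' ↦ ?_
    obtain ⟨hne, hsub⟩ := Finset.mem_erase.1 hE'
    exact tendsto_scaled_JE_of_nonempty hP hΦb hΦs (Finset.mem_powerset.1 hsub) (Finset.nonempty_iff_ne_empty.2 hne)
  rw [add_zero] at hlim
  exact hlim.congr' (hdecomp.mono fun T hT ↦ hT.symm)

/-! ## The density integrals `I_m(T) ∼ T Lᵐ` -/

/-- `(log T)⁻¹ → 0` variants: `(L + c)/L → 1`. [folklore] -/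
theorem tendsto_log_add_div_log (c : ℝ) : Tendsto (fun T : ℝ ↦ (Real.log T + c) / Real.log T) atTop (𝓝 1) := by
  have h := (tendsto_inv_log.const_mul c).const_add 1
  rw [mul_zero, add_zero] at h
  refine h.congr' ?_
  filter_upwards [eventually_gt_atTop (1 : ℝ)] with T hT
  have hL : Real.log T ≠ 0 := (Real.log_pos hT).ne'
  field_simp

/-- `log(log T)/log T → 0`. [folklore] -/
theorem tendsto_loglog_div_log : Tendsto (fun T : ℝ ↦ Real.log (Real.log T) / Real.log T) atTop (𝓝 0) := by
  have h := (Real.tendsto_pow_log_div_mul_add_atTop 1 0 1 one_ne_zero).comp Real.tendsto_log_atTop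
  refine h.congr' (Eventually.of_forall fun T ↦ ?_)
  simp

/-- **`I_m(T)/(T Lᵐ) → 1`** (Rudnick–Sarnak 1996, Lemma 3.6 with `h ≡ 1`: `∫_0^T ℓ^m ∼ T (log T)^m`).
[cite: RudnickSarnak1996, Lemma 3.6] -/
theorem tendsto_ellInt_div (m : ℕ) : Tendsto (fun T : ℝ ↦ ellInt m T / (T * Real.log T ^ m)) atTop (𝓝 1) := by
  -- upper bound `((L+4)/L)^m`, lower bound `(1 − 1/L)((L − log L − 2)/L)^m − (1/L)((L+4)/L)^m`
  set u : ℝ → ℝ := fun T ↦ ((Real.log T + 4) / Real.log T) ^ m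
  set v : ℝ → ℝ := fun T ↦ (1 - (Real.log T)⁻¹) * ((Real.log T - Real.log (Real.log T) - 2) / Real.log T) ^ m -
    (Real.log T)⁻¹ * ((Real.log T + 4) / Real.log T) ^ m
  have hu : Tendsto u atTop (𝓝 1) := by
    have := (tendsto_log_add_div_log 4).pow m
    simpa [u] using this
  have hv : Tendsto v atTop (𝓝 1) := by
    have h1 : Tendsto (fun T : ℝ ↦ (Real.log T - Real.log (Real.log T) - 2) / Real.log T) atTop (𝓝 1) := by
      have h := ((tendsto_loglog_div_log).add (tendsto_inv_log.const_mul 2)).const_sub 1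
      rw [mul_zero, add_zero, sub_zero] at h
      refine h.congr' ?_
      filter_upwards [eventually_gt_atTop (1 : ℝ)] with T hT
      have hL : Real.log T ≠ 0 := (Real.log_pos hT).ne'
      field_simp
      ring
    have h2 : Tendsto (fun T : ℝ ↦ 1 - (Real.log T)⁻¹) atTop (𝓝 1) := by
      have := tendsto_inv_log.const_sub 1; simpa using this
    have h3 := (h2.mul (h1.pow m)).sub (tendsto_inv_log.mul ((tendsto_log_add_div_log 4).pow m))
    simpa [v] using h3
  refine tendsto_of_tendsto_of_tendsto_of_le_of_le' hv hu ?_ ?_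
  · -- lower bound, eventually
    have hev : ∀ᶠ T : ℝ in atTop, 0 ≤ Real.log T - Real.log (Real.log T) - 2 := by
      have h := tendsto_loglog_div_log
      have h2 : ∀ᶠ T : ℝ in atTop, Real.log (Real.log T) / Real.log T ≤ 1 / 2 :=
        h.eventually (ge_mem_nhds (by norm_num))
      filter_upwards [h2, eventually_ge_atTop (Real.exp 4)] with T hT hT4
      have hTpos : 0 < T := lt_of_lt_of_le (Real.exp_pos 4) hT4
      have hL : 4 ≤ Real.log T := by rw [Real.le_log_iff_exp_le hTpos]; exact hT4
      have hL0 : 0 < Real.log T := by linarith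
      rw [div_le_iff₀ hL0] at hT
      linarith
    filter_upwards [hev, eventually_ge_atTop (Real.exp 4)] with T hA hT4
    have hTpos : 0 < T := lt_of_lt_of_le (Real.exp_pos 4) hT4
    have hL4 : 4 ≤ Real.log T := by rw [Real.le_log_iff_exp_le hTpos]; exact hT4
    set L := Real.log T
    have hL1 : 1 ≤ L := by linarith
    have hL0 : 0 < L := by linarith
    have hT3 : 3 ≤ T := le_trans (by have := Real.add_one_le_exp (4:ℝ); linarith) hT4
    have hT0 : 0 < T := by linarith
    set A := L - Real.log L - 2
    set T₁ := T / L
    have hT₁pos : 0 < T₁ := div_pos hT0 hL0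
    have hT₁le : T₁ ≤ T := div_le_self hT0.le hL1
    have hlogT₁ : Real.log T₁ = L - Real.log L := by simp only [T₁, L]; rw [Real.log_div hT0.ne' hL0.ne']
    -- `ℓ ≥ A ≥ 0` on `[T₁, T]`
    have hell : ∀ t ∈ Set.Icc T₁ T, A ≤ ell t := by
      intro t ht
      have ht0 : 0 < t := lt_of_lt_of_le hT₁pos ht.1
      obtain ⟨h1, -⟩ := ell_sub_log_mem ht0.ne'
      rw [abs_of_pos ht0, Real.log_div ht0.ne' (by positivity)] at h1
      have hlt : Real.log T₁ ≤ Real.log t := Real.log_le_log hT₁pos ht.1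
      have h2π : Real.log (2 * π) ≤ 2 := by
        rw [Real.log_le_iff_le_exp (by positivity)]
        have he2 : Real.exp 2 = Real.exp 1 * Real.exp 1 := by rw [← Real.exp_add]; norm_num
        rw [he2]
        nlinarith [Real.exp_one_gt_d9, Real.pi_lt_d2, Real.exp_pos 1]
      simp only [A]; linarith
    -- the two pieces
    have hsplit : ellInt m T = (∫ t in (0:ℝ)..T₁, ell t ^ m) + ∫ t in T₁..T, ell t ^ m := by
      unfold ellInt
      rw [intervalIntegral.integral_add_adjacent_intervals]
      all_goals exact (continuous_ell.pow m).intervalIntegrable _ _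
    have hT₁2 : 2 ≤ T₁ := by
      simp only [T₁]
      rw [le_div_iff₀ hL0]
      have hq := Real.quadratic_le_exp_of_nonneg hL0.le
      rw [Real.exp_log hT0] at hq
      nlinarith
    have hpiece1 : -(T₁ * (L + 4) ^ m) ≤ ∫ t in (0:ℝ)..T₁, ell t ^ m := by
      have h := abs_ellInt_le hT₁2 m
      unfold ellInt at h
      have hlog : Real.log T₁ + 4 ≤ L + 4 := by linarith [Real.log_le_log hT₁pos hT₁le]
      have h2 : T₁ * (Real.log T₁ + 4) ^ m ≤ T₁ * (L + 4) ^ m :=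
        mul_le_mul_of_nonneg_left (pow_le_pow_left₀ (by linarith [Real.log_nonneg (by linarith : (1:ℝ) ≤ T₁)]) hlog m) hT₁pos.le
      linarith [neg_abs_le (∫ t in (0:ℝ)..T₁, ell t ^ m)]
    have hpiece2 : (T - T₁) * A ^ m ≤ ∫ t in T₁..T, ell t ^ m := by
      have h := intervalIntegral.integral_mono_on (f := fun _ : ℝ ↦ A ^ m) (g := fun t ↦ ell t ^ m) (μ := volume) hT₁le
        (continuous_const.intervalIntegrable _ _) ((continuous_ell.pow m).intervalIntegrable _ _)
        (fun t ht ↦ pow_le_pow_left₀ hA (hell t ht) m)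
      rwa [intervalIntegral.integral_const, smul_eq_mul] at h
    simp only [v]
    rw [le_div_iff₀ (by positivity)]
    have e : ((1 - L⁻¹) * (A / L) ^ m - L⁻¹ * ((L + 4) / L) ^ m) * (T * L ^ m) = (T - T₁) * A ^ m - T₁ * (L + 4) ^ m := by
      simp only [T₁]
      rw [div_pow, div_pow]
      field_simp
    rw [e, hsplit]
    linarith
  · -- upper bound, eventually
    filter_upwards [eventually_ge_atTop (3 : ℝ)] with T hT
    have hL := one_le_log hT
    have hT0 : 0 < T := by linarith
    have h := abs_ellInt_le (by linarith : (2:ℝ) ≤ T) m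
    simp only [u]
    rw [div_le_iff₀ (by positivity), div_pow, div_mul_eq_mul_div, le_div_iff₀ (by positivity)]
    calc ellInt m T * Real.log T ^ m ≤ |ellInt m T| * Real.log T ^ m := mul_le_mul_of_nonneg_right (le_abs_self _) (by positivity)
      _ ≤ T * (Real.log T + 4) ^ m * Real.log T ^ m := mul_le_mul_of_nonneg_right h (by positivity)
      _ = (Real.log T + 4) ^ m * (T * Real.log T ^ m) := by ring

/-! ## The limit of `cellCoef · cellMain/(T L)` -/

/-- **The limit of a cell of the main term** (Rudnick–Sarnak 1996, (3.65)–(3.74)): for `P ⊆ Dᶜ` and a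
continuous bounded box-supported `Φ`,
`cellCoef_T(D) · cellMain_T(D, P)/(T log T) → c_n Σ_{β : P ≃ Q} I_β(Φ)`. [cite: RudnickSarnak1996, (3.74)] -/
theorem tendsto_cellCoef_mul_cellMain_div (hP : P ⊆ Finset.univ \ D) {Φ : (Fin (k + 1) → ℝ) → ℂ} {MΦ : ℝ}
    (hΦc : Continuous Φ) (hΦb : ∀ ξ, ‖Φ ξ‖ ≤ MΦ) (hΦs : ∀ ξ, Φ ξ ≠ 0 → ∀ j, |ξ j| ≤ 2) :
    Tendsto (fun T : ℝ ↦ cellCoef T D * cellMain Φ T D P / ((T : ℂ) * (Real.log T : ℂ))) atTop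
      (𝓝 ((levelConst (k + 1) : ℂ) * ∑ β' : (↥P ≃ ↥((Finset.univ \ D) \ P)), pairInt D P β' Φ)) := by
  classical
  have hΦi := integrable_phi_slicePt hΦc hΦb hΦs
  set d := D.card
  set S := Finset.univ \ D
  -- algebra, eventually
  have hev : ∀ᶠ T : ℝ in atTop, cellCoef T D * cellMain Φ T D P / ((T : ℂ) * (Real.log T : ℂ)) =
      (-1 : ℂ) ^ S.card * (((ellInt d T / (T * Real.log T ^ d) : ℝ)) : ℂ) *
        ∑ β' : (↥P ≃ ↥((Finset.univ \ D) \ P)), (((Real.log T ^ d / Real.log T : ℝ)) : ℂ) * Jbeta D P β' Φ T := by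
    filter_upwards [eventually_gt_atTop (1 : ℝ)] with T hT
    have hL : Real.log T ≠ 0 := (Real.log_pos hT).ne'
    have hT0 : (T : ℂ) ≠ 0 := by exact_mod_cast (by linarith : T ≠ 0)
    have hLc : (Real.log T : ℂ) ≠ 0 := by exact_mod_cast hL
    rw [cellMain_eq_sum_Jbeta hΦi hΦs, ← Finset.mul_sum]
    unfold cellCoef
    have e : (((ellInt d T / (T * Real.log T ^ d) : ℝ)) : ℂ) * (((Real.log T ^ d / Real.log T : ℝ)) : ℂ) =
        (ellInt d T : ℂ) / ((T : ℂ) * (Real.log T : ℂ)) := by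
      push_cast
      field_simp
    calc (-1 : ℂ) ^ (Finset.univ \ D).card * (ellInt D.card T : ℂ) * (∑ β' : (↥P ≃ ↥((Finset.univ \ D) \ P)), Jbeta D P β' Φ T) /
          ((T : ℂ) * (Real.log T : ℂ))
        = (-1 : ℂ) ^ S.card * ((ellInt d T : ℂ) / ((T : ℂ) * (Real.log T : ℂ))) *
            ∑ β' : (↥P ≃ ↥((Finset.univ \ D) \ P)), Jbeta D P β' Φ T := by simp only [S, d]; ring
      _ = _ := by rw [← e]; ring
  -- the limit of the right-hand side
  have hlim : Tendsto (fun T : ℝ ↦ (-1 : ℂ) ^ S.card * (((ellInt d T / (T * Real.log T ^ d) : ℝ)) : ℂ) *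
      ∑ β' : (↥P ≃ ↥((Finset.univ \ D) \ P)), (((Real.log T ^ d / Real.log T : ℝ)) : ℂ) * Jbeta D P β' Φ T) atTop
      (𝓝 ((-1 : ℂ) ^ S.card * (1 : ℂ) * ∑ β' : (↥P ≃ ↥((Finset.univ \ D) \ P)), (levelConst (k + 1) : ℂ) * pairInt D P β' Φ)) := by
    refine Tendsto.mul (Tendsto.mul tendsto_const_nhds ?_) (tendsto_finsetSum _ fun β' _ ↦ tendsto_scaled_Jbeta hP hΦc hΦb hΦs)
    have h := (Complex.continuous_ofReal.tendsto 1).comp (tendsto_ellInt_div d)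
    rw [Complex.ofReal_one] at h
    exact h
  -- identify the limit
  have hval : (-1 : ℂ) ^ S.card * (1 : ℂ) * ∑ β' : (↥P ≃ ↥((Finset.univ \ D) \ P)), (levelConst (k + 1) : ℂ) * pairInt D P β' Φ =
      (levelConst (k + 1) : ℂ) * ∑ β' : (↥P ≃ ↥((Finset.univ \ D) \ P)), pairInt D P β' Φ := by
    by_cases hne : Nonempty (↥P ≃ ↥((Finset.univ \ D) \ P))
    · obtain ⟨β₀⟩ := hne
      have hPQ : P.card = ((Finset.univ \ D) \ P).card := by
        have := Fintype.card_congr β₀; simp only [Fintype.card_coe] at this; exact this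
      have hS : S.card = 2 * P.card := by
        have := card_add_card_sdiff' (k := k) hP
        simp only [S]; omega
      rw [hS, pow_mul, neg_one_sq, one_pow, one_mul, one_mul, Finset.mul_sum]
    · rw [not_nonempty_iff] at hne
      simp
  rw [← hval]
  exact hlim.congr' (hev.mono fun T hT ↦ hT.symm)

end Pattern

end RudnickSarnakN

end Literature.NumberTheory.LFunctions

end
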